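import Mathlib.Analysis.Calculus.Deriv.Slope
import Literature.Analysis.FunctionSpaces.TorusAxisAverage
import Literature.Analysis.FunctionSpaces.TorusVectorParseval
import Literature.Analysis.FluidPDE.StokesTorus
import Literature.Analysis.FluidPDE.NSHopfLimit
import Literature.Analysis.FluidPDE.NSHopfEnergy
import Literature.Analysis.FluidPDE.NSHopfGalerkinEnstrophy2D
import Literature.Analysis.FluidPDE.NSGalerkinTimeBookkeeping
import Literature.Analysis.FluidPDE.NSStrongSolutions2DProofs
import Literature.Analysis.FluidPDE.NSUniqueness2DProofs
import Literature.Analysis.FluidPDE.LerayHopfSpectralMeasurability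
import Literature.Analysis.FluidPDE.ZerothLaw
import HarnessLib

/-!
# The zeroth law in two dimensions: no anomalous energy dissipation for the damped and driven
  Navier–Stokes equations — discharge of `constantin_ramos_2d` (turb.S25)

Sibling proof file of `Literature.Analysis.FluidPDE.ZerothLaw`. It proves the named fact
`Literature.Analysis.FluidPDE.constantin_ramos_2d` (Constantin–Ramos, *Inviscid limit for damped
and driven incompressible Navier–Stokes equations in `ℝ²`*, Comm. Math. Phys. 275 (2007) =
arXiv:math/0611782; §1, p. 2: "Our results apply to the spatially periodic boundary conditions
as well. The absence of anomalous dissipation of energy follows immediately from the bounds in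
the second section"; §2, Thm 2.1: energy equality `d/2dt∫|u|² + γ∫|u|² + ν∫|∇u|² = ∫f·u`, the
vorticity equation `∂ₜω + u·∇ω - νΔω + γω = g = ∇⊥·f`, and the enstrophy bound
`‖ω(t)‖₂ ≤ e^{-γt}{‖ω₀‖₂ - γ⁻¹‖g‖₂} + γ⁻¹‖g‖₂`, "bounded uniformly in time, with bounds
independent of viscosity"): on `𝕋²`, for `γ > 0`, a steady Lipschitz force `f`, an `L²` datum,
viscosities `νⱼ → 0` and global Leray–Hopf solutions `uⱼ` of the systems forced by `f - γuⱼ`,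
the mean energy dissipation rate `νⱼ⟨‖∇uⱼ‖₂²⟩` (limsup of running means, spectral gradients)
tends to `0` — `constantin_ramos_2d_holds`.

## The argument and its Lean rendering

The printed mechanism is the enstrophy balance with damping: `‖∇u‖₂ = ‖ω‖₂` stays bounded
independently of `ν`, so `ν⟨‖∇u‖₂²⟩ = O(ν)`. For `L²` data the enstrophy is infinite at `t = 0`
(the paper's bounds are for `u₀ ∈ H¹`, and its Thms 2.2, 5.2 work from `t₀ > 0`), and the
tree's solutions are rough Leray–Hopf solutions; both points are handled by using the
**time-integrated** damped enstrophy balance on `[σ, t]`, `σ > 0`, which controls the Cesàro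
means directly, and by proving it at the level of the Fourier–Galerkin approximations:

* Part A (`sum_stokesEigenvalue_mul_norm_sq_le_of_lipschitz`): a Lipschitz field on `T^d` has
  `∑_{k∈S} 4π²|k|²‖f̂(k)‖² ≤ d·K²` on every finite `S` (Parseval for the increments
  `f(· + h eᵢ) - f`, `𝓕` of an axis translate, `|e^{2πikᵢh} - 1|²/h² → 4π²kᵢ²`).
* Part B (`galerkin_damped_enstrophy_ineq`): along the Galerkin ODE on `𝕋²` with force
  coefficients `G`, the 2-D enstrophy identity `d/dt‖∇U‖² = -2(ν‖ΔU‖² + ∫⟪G, ΔU⟫)`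
  (`hasDerivWithinAt_toReal_eGradNormSq_fin_two`, FMRT 2001 (A.62)/(A.65)) gives, writing
  `G = E + f - γU`, `‖∇U(t)‖² + γ∫ₛᵗ‖∇U‖² ≤ ‖∇U(s)‖² + ν⁻¹∫ₛᵗ∫‖E‖² + (t-s)Z_f/γ`
  (Young for `E`, Fourier Cauchy–Schwarz `(∫⟪f,ΔU⟫)² ≤ Z_f‖∇U‖²` for `f`, `∫⟪U,ΔU⟫ = -‖∇U‖²`).
* Part C (`damped_enstrophy_integral_bound`): for a global Leray–Hopf solution `u` of the damped
  system, run the tree's Hopf–Galerkin scheme for the Navier–Stokes problem with the FROZEN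
  force `F = f - γu ∈ L²ₜₓ` (`exists_hopfGalerkinScheme_coeffs`); its error
  `E_n = G_n - f + γU_n = (G_n - F) + γ(U_n - u) → 0` in `L²((0,t) × 𝕋²)` along the
  subsequence of `exists_limitField` (`tendsto_force`, `tendsto_lintegral_enorm_sub_sq`, and
  `u = ` the Leray–Hopf limit a.e. by the Lions–Prodi uniqueness theorem
  `lions_prodi_uniqueness_torus2_holds`, FMRT 2001 Thm 7.3); the enstrophy at the starting
  time is controlled through the energy bound by a first-moment selection in `(0, σ)`, and
  Fatou in time gives `∫_σ^t ‖∇u‖₂² ≤ C + t·2K²/γ²` with the slope independent of `ν`.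
* Part D (`meanDissipation_le_of_damped`, `constantin_ramos_2d_holds`): the running means of
  `ν‖∇u‖₂²` are `≤ νC'/T + ν·2K²/γ²`, so `0 ≤ ⟨ν‖∇u‖₂²⟩ ≤ ν·2K²/γ²`; squeeze as `νⱼ → 0`.

The weak divergence-freeness of `f` in the statement is not used (a gradient part of the force
is invisible to Leray–Hopf solutions). No new definitions or named facts are introduced; axioms
`propext`, `Classical.choice`, `Quot.sound` only.

## Mathlib / tree search

Reused: the Hopf–Galerkin machinery (`NSHopfGalerkinExistence`, `NSHopfLimit`,
`NSHopfGalerkinLimit`, `NSHopfGalerkinEnstrophy2D`, `NSGalerkinTimeBookkeeping`), the 2-D Galerkin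
enstrophy identity and its Fourier lemmas (`NSStrongSolutions2DProofs`, `NSGalerkinEnstrophy2D`),
2-D uniqueness (`NSUniqueness2DProofs`), spectral measurability of Leray–Hopf slices
(`LerayHopfSpectralMeasurability`), Parseval and axis translates on the torus
(`TorusVectorParseval`, `TorusAxisAverage`); from Mathlib `hasDerivAt_fourier`,
`HasDerivAt.tendsto_slope_zero`, `QuotientAddGroup.norm_mk_le_norm`,
`Finset.sum_sq_le_sum_mul_sum_of_sq_le_mul`, `lintegral_liminf_le'`, `integral_toReal`,
`limsup_le_of_le`, `le_limsup_of_frequently_le`. Nothing on damped Navier–Stokes existed in the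
tree (searched `damped`, `Constantin`, `frozen`).

## References

* P. Constantin, F. Ramos, *Inviscid limit for damped and driven incompressible Navier–Stokes
  equations in `ℝ²`*, Comm. Math. Phys. 275 (2007), 529–551, arXiv:math/0611782, §1 (p. 2) and
  §2, Thm 2.1. [ConstantinRamos2007]
* C. Foias, O. Manley, R. Rosa, R. Temam, *Navier–Stokes Equations and Turbulence*, CUP 2001,
  Ch. II Thm. 7.3 (uniqueness), App. II.A (A.62), (A.65) (2-D enstrophy equation).
  [FoiasManleyRosaTemam2001]
-/

open MeasureTheory Set Filter Topology UnitAddTorus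
open scoped ENNReal NNReal InnerProductSpace

noncomputable section

namespace Literature.Analysis.FluidPDE

open FunctionSpaces FunctionSpaces.Torus Torus

/-! ## Part A. Lipschitz fields have finite enstrophy (Fourier side) -/

section Lipschitz

variable {d : Type*} [Fintype d] [DecidableEq d]

/-- An axis translate `x + h eᵢ` of a point of `T^d` is within `|h|` of it (sup metric on the
product, quotient norm `‖(h : ℝ/ℤ)‖ ≤ |h|` on the factor). [folklore] -/
theorem dist_add_single_coe_le (x : UnitAddTorus d) (i : d) (h : ℝ) :
    dist (x + (Pi.single i ((h : ℝ) : UnitAddCircle) : UnitAddTorus d)) x ≤ |h| := by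
  refine (dist_pi_le_iff (abs_nonneg h)).2 fun j => ?_
  by_cases hj : j = i
  · subst hj
    rw [Pi.add_apply, Pi.single_eq_same, dist_eq_norm, add_sub_cancel_left]
    exact (QuotientAddGroup.norm_mk_le_norm (S := AddSubgroup.zmultiples (1 : ℝ)) (m := h)).trans_eq
      (Real.norm_eq_abs h)
  · rw [Pi.add_apply, Pi.single_eq_of_ne hj, add_zero, dist_self]
    exact abs_nonneg h

/-- **`L²` increments of a Lipschitz field along an axis**: `∫ ‖f(x + h eᵢ) - f(x)‖² ≤ (K|h|)²`. [folklore] -/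
theorem integral_norm_translate_sub_sq_le {f : UnitAddTorus d → EuclideanSpace ℝ d} {K : ℝ≥0}
    (hf : LipschitzWith K f) (i : d) (h : ℝ) :
    ∫ x, ‖f (x + (Pi.single i ((h : ℝ) : UnitAddCircle) : UnitAddTorus d)) - f x‖ ^ 2 ≤ ((K : ℝ) * |h|) ^ 2 := by
  set C : ℝ := ((K : ℝ) * |h|) ^ 2 with hC
  have hcont : Continuous f := hf.continuous
  have hpt : ∀ x, ‖f (x + (Pi.single i ((h : ℝ) : UnitAddCircle) : UnitAddTorus d)) - f x‖ ^ 2 ≤ C := by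
    intro x
    have h1 : ‖f (x + (Pi.single i ((h : ℝ) : UnitAddCircle) : UnitAddTorus d)) - f x‖ ≤ (K : ℝ) * |h| := by
      rw [← dist_eq_norm]
      exact (hf.dist_le_mul _ _).trans
        (mul_le_mul_of_nonneg_left (dist_add_single_coe_le x i h) (NNReal.coe_nonneg K))
    rw [hC]
    exact pow_le_pow_left₀ (norm_nonneg _) h1 2
  have hint : Integrable (fun x => ‖f (x + (Pi.single i ((h : ℝ) : UnitAddCircle) : UnitAddTorus d)) - f x‖ ^ 2) volume :=
    (((hcont.comp (continuous_add_const ((Pi.single i ((h : ℝ) : UnitAddCircle) : UnitAddTorus d)))).sub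
      hcont).norm.pow 2).integrable_unitAddTorus
  calc ∫ x, ‖f (x + (Pi.single i ((h : ℝ) : UnitAddCircle) : UnitAddTorus d)) - f x‖ ^ 2
      ≤ ∫ _ : UnitAddTorus d, C := integral_mono hint (integrable_const C) hpt
    _ = C := by
        rw [integral_const, smul_eq_mul]
        simp

/-- **Fourier coefficients of an axis increment**: `𝓕(f(· + s eᵢ) - f)(k) = (e_{kᵢ}(s) - 1) f̂(k)`
(for the complexified field; `Torus.mFourierCoeff_comp_add_single`). [folklore] -/
theorem mFourierCoeff_complexify_translate_sub {f : UnitAddTorus d → EuclideanSpace ℝ d}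
    (hf : Continuous f) (i : d) (s : UnitAddCircle) (k : d → ℤ) :
    mFourierCoeff (EuclideanSpace.complexify ∘ fun x => f (x + (Pi.single i s : UnitAddTorus d)) - f x) k =
      ((fourier (k i) s : ℂ) - 1) • mFourierCoeff (EuclideanSpace.complexify ∘ f) k := by
  have hint : Integrable f volume := hf.integrable_unitAddTorus
  have hint' : Integrable (fun x => f (x + (Pi.single i s : UnitAddTorus d))) volume :=
    (hf.comp (continuous_add_const (Pi.single i s : UnitAddTorus d))).integrable_unitAddTorus
  have h1 : (fun x => f (x + (Pi.single i s : UnitAddTorus d)) - f x) =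
      (fun x => f (x + (Pi.single i s : UnitAddTorus d))) - f := rfl
  rw [h1, Torus.mFourierCoeff_complexify_sub hint' hint, sub_smul, one_smul]
  congr 1
  exact mFourierCoeff_comp_add_single (EuclideanSpace.complexify ∘ f) k i s

/-- The difference quotients of a character at `0`: `‖e_n(h) - 1‖ / |h| → 2π|n|` as `h → 0`,
`h ≠ 0` (`hasDerivAt_fourier`: the derivative of `h ↦ e_n(h)` at `0` is `2πi n`). [folklore] -/
theorem tendsto_norm_fourier_coe_sub_one_div (n : ℤ) :
    Tendsto (fun h : ℝ => ‖(fourier n ((h : ℝ) : UnitAddCircle) : ℂ) - 1‖ / |h|) (𝓝[≠] 0)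
      (𝓝 (2 * Real.pi * |(n : ℝ)|)) := by
  have hd := hasDerivAt_fourier 1 n 0
  have h0 : (fourier n (((0 : ℝ) : AddCircle (1 : ℝ))) : ℂ) = 1 := by
    rw [QuotientAddGroup.mk_zero]
    exact fourier_eval_zero n
  have hslope := hd.tendsto_slope_zero
  simp only [zero_add, h0, mul_one] at hslope
  have h2 := hslope.norm
  simp only [Complex.ofReal_one, div_one] at h2
  have hval : ‖(2 * Real.pi * Complex.I * n : ℂ)‖ = 2 * Real.pi * |(n : ℝ)| := by
    rw [norm_mul, norm_mul, norm_mul, Complex.norm_I, mul_one, Complex.norm_intCast, Complex.norm_real,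
      Real.norm_eq_abs, abs_of_pos Real.pi_pos, Complex.norm_ofNat]
  rw [hval] at h2
  refine h2.congr fun h => ?_
  rw [norm_smul, norm_inv, Real.norm_eq_abs, div_eq_inv_mul]

/-- **Lipschitz fields have finite enstrophy, one direction at a time**: for `f` Lipschitz with
constant `K` on `T^d` and every finite set of frequencies,
`∑_{k∈S} 4π²kᵢ² ‖f̂(k)‖² ≤ K²` (Parseval for the increment `f(· + h eᵢ) - f`, whose squared
`L²` norm is `≤ K²h²`, and `‖e_{kᵢ}(h) - 1‖²/h² → 4π²kᵢ²`). [folklore] -/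
theorem sum_sq_mul_norm_mFourierCoeff_sq_le_of_lipschitz {f : UnitAddTorus d → EuclideanSpace ℝ d}
    {K : ℝ≥0} (hf : LipschitzWith K f) (i : d) (S : Finset (d → ℤ)) :
    ∑ k ∈ S, 4 * Real.pi ^ 2 * ((k i : ℤ) : ℝ) ^ 2 *
      ‖mFourierCoeff (EuclideanSpace.complexify ∘ f) k‖ ^ 2 ≤ (K : ℝ) ^ 2 := by
  have hcont : Continuous f := hf.continuous
  set a : (d → ℤ) → ℝ := fun k => ‖mFourierCoeff (EuclideanSpace.complexify ∘ f) k‖ with ha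
  -- for `h ≠ 0`: the difference quotients
  have hbound : ∀ h : ℝ, h ≠ 0 →
      ∑ k ∈ S, (‖(fourier (k i) ((h : ℝ) : UnitAddCircle) : ℂ) - 1‖ / |h|) ^ 2 * a k ^ 2 ≤ (K : ℝ) ^ 2 := by
    intro h hh
    have hmem : MemLp (fun x => f (x + (Pi.single i ((h : ℝ) : UnitAddCircle) : UnitAddTorus d)) - f x) 2 volume :=
      ((hcont.comp (continuous_add_const _)).sub hcont).memLp_of_hasCompactSupport
        (HasCompactSupport.of_compactSpace _)
    have hpar := hasSum_sq_norm_mFourierCoeff_complexify hmem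
    have hle := (sum_le_hasSum S (fun k _ => sq_nonneg _) hpar).trans
      (integral_norm_translate_sub_sq_le hf i h)
    simp_rw [mFourierCoeff_complexify_translate_sub hcont i _ , norm_smul] at hle
    have hh2 : 0 < |h| ^ 2 := by positivity
    have hK : (K : ℝ) ^ 2 = ((K : ℝ) * |h|) ^ 2 / |h| ^ 2 := by
      field_simp
    rw [hK, le_div_iff₀ hh2, Finset.sum_mul]
    refine le_trans (le_of_eq (Finset.sum_congr rfl fun k _ => ?_)) hle
    rw [ha]
    field_simp
  -- the limit `h → 0`
  have hlim : Tendsto (fun h : ℝ =>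
      ∑ k ∈ S, (‖(fourier (k i) ((h : ℝ) : UnitAddCircle) : ℂ) - 1‖ / |h|) ^ 2 * a k ^ 2) (𝓝[≠] 0)
      (𝓝 (∑ k ∈ S, (2 * Real.pi * |((k i : ℤ) : ℝ)|) ^ 2 * a k ^ 2)) :=
    tendsto_finsetSum _ fun k _ => ((tendsto_norm_fourier_coe_sub_one_div (k i)).pow 2).mul_const _
  have hev : ∀ᶠ h : ℝ in 𝓝[≠] 0,
      ∑ k ∈ S, (‖(fourier (k i) ((h : ℝ) : UnitAddCircle) : ℂ) - 1‖ / |h|) ^ 2 * a k ^ 2 ≤ (K : ℝ) ^ 2 :=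
    eventually_nhdsWithin_of_forall fun h hh => hbound h hh
  have hle := le_of_tendsto hlim hev
  refine le_trans (le_of_eq (Finset.sum_congr rfl fun k _ => ?_)) hle
  rw [ha, mul_pow, mul_pow, sq_abs]
  ring

/-- **Lipschitz fields have finite enstrophy** (all directions): for `f` Lipschitz with constant
`K` on `T^d` and every finite set of frequencies, `∑_{k∈S} 4π²|k|² ‖f̂(k)‖² ≤ (card d) K²`, i.e.
the partial sums of the spectral `‖∇f‖₂²` are bounded by `d·K²` (`‖∂ᵢf‖_∞ ≤ K`). [folklore] -/
theorem sum_stokesEigenvalue_mul_norm_sq_le_of_lipschitz {f : UnitAddTorus d → EuclideanSpace ℝ d}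
    {K : ℝ≥0} (hf : LipschitzWith K f) (S : Finset (d → ℤ)) :
    ∑ k ∈ S, stokesEigenvalue k * ‖mFourierCoeff (EuclideanSpace.complexify ∘ f) k‖ ^ 2 ≤
      Fintype.card d * (K : ℝ) ^ 2 := by
  have h := fun i => sum_sq_mul_norm_mFourierCoeff_sq_le_of_lipschitz hf i S
  calc ∑ k ∈ S, stokesEigenvalue k * ‖mFourierCoeff (EuclideanSpace.complexify ∘ f) k‖ ^ 2
      = ∑ i : d, ∑ k ∈ S, 4 * Real.pi ^ 2 * ((k i : ℤ) : ℝ) ^ 2 *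
          ‖mFourierCoeff (EuclideanSpace.complexify ∘ f) k‖ ^ 2 := by
        rw [Finset.sum_comm]
        refine Finset.sum_congr rfl fun k _ => ?_
        rw [stokesEigenvalue, freqNormSq, Finset.mul_sum, Finset.sum_mul]
    _ ≤ ∑ _i : d, (K : ℝ) ^ 2 := Finset.sum_le_sum fun i _ => h i
    _ = Fintype.card d * (K : ℝ) ^ 2 := by
        rw [Finset.sum_const, Finset.card_univ, nsmul_eq_mul]

end Lipschitz

/-! ## Part B. The damped enstrophy inequality of the Galerkin approximations -/

/-! ### The damped enstrophy rate of a Galerkin state (pointwise in time), `d = 2` -/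

section Rate

variable {d : Type*} [Fintype d] [DecidableEq d] {S : Finset (d → ℤ)}

/-- `∫ ⟪u, Δu⟫ = -‖∇u‖₂²` for a real trigonometric polynomial (Fourier side:
`∑ Re⟪c k, -4π²|k|² c k⟫ = -4π² ∑ |k|² ‖c k‖²`). [folklore] -/
theorem integral_inner_laplacian_realTrigPoly_self (hS : ∀ k ∈ S, -k ∈ S)
    {c : (d → ℤ) → EuclideanSpace ℂ d} (hc : IsConjSymm c) :
    ∫ x, ⟪realTrigPoly S c x, laplacian (realTrigPoly S c) x⟫_ℝ =
      -(eGradNormSq (realTrigPoly S c)).toReal := by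
  have hlap : laplacian (realTrigPoly S c) =
      realTrigPoly S (fun k => -(((4 * Real.pi ^ 2 * freqNormSq k : ℝ) : ℂ) • c k)) :=
    funext fun x => laplacian_realTrigPoly S _ x
  rw [hlap, integral_inner_realTrigPoly_realTrigPoly hS hc (isConjSymm_laplacianCoeff hc),
    toReal_eGradNormSq_realTrigPoly hS hc, Finset.mul_sum, ← Finset.sum_neg_distrib]
  refine Finset.sum_congr rfl fun k _ => ?_
  rw [inner_neg_right, Complex.neg_re, inner_smul_right, Complex.re_ofReal_mul, ← RCLike.re_to_complex,
    inner_self_eq_norm_sq]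
  ring

/-- **Fourier Cauchy–Schwarz for the force pairing**: for `f ∈ L²` with
`∑_{k∈S'} 4π²|k|² ‖f̂(k)‖² ≤ Z_f` on all finite `S'`, and a real trigonometric polynomial `u`,
`(∫ ⟪f, Δu⟫)² ≤ Z_f ‖∇u‖₂²` (`∫⟪f,Δu⟫ = -∑ 4π²|k|² Re⟪f̂ k, c k⟫`). [folklore] -/
theorem sq_integral_inner_laplacian_realTrigPoly_le (hS : ∀ k ∈ S, -k ∈ S)
    {c : (d → ℤ) → EuclideanSpace ℂ d} (hc : IsConjSymm c)
    {f : UnitAddTorus d → EuclideanSpace ℝ d} (hf : MemLp f 2 volume) {Zf : ℝ}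
    (hZf : ∀ S' : Finset (d → ℤ), ∑ k ∈ S', stokesEigenvalue k *
      ‖mFourierCoeff (EuclideanSpace.complexify ∘ f) k‖ ^ 2 ≤ Zf) :
    (∫ x, ⟪f x, laplacian (realTrigPoly S c) x⟫_ℝ) ^ 2 ≤ Zf * (eGradNormSq (realTrigPoly S c)).toReal := by
  set a : (d → ℤ) → ℝ := fun k => ‖mFourierCoeff (EuclideanSpace.complexify ∘ f) k‖ with ha
  have hlap : laplacian (realTrigPoly S c) =
      realTrigPoly S (fun k => -(((4 * Real.pi ^ 2 * freqNormSq k : ℝ) : ℂ) • c k)) :=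
    funext fun x => laplacian_realTrigPoly S _ x
  have hpair : ∫ x, ⟪f x, laplacian (realTrigPoly S c) x⟫_ℝ =
      ∑ k ∈ S, (inner ℂ (mFourierCoeff (EuclideanSpace.complexify ∘ f) k)
        (-(((4 * Real.pi ^ 2 * freqNormSq k : ℝ) : ℂ) • c k))).re := by
    rw [hlap, integral_inner_realTrigPoly_right hS (isConjSymm_laplacianCoeff hc) hf]
  -- termwise bound `|Re⟪f̂ k, -λ_k c k⟫| ≤ λ_k ‖f̂ k‖ ‖c k‖`
  have hterm : ∀ k ∈ S, |(inner ℂ (mFourierCoeff (EuclideanSpace.complexify ∘ f) k)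
      (-(((4 * Real.pi ^ 2 * freqNormSq k : ℝ) : ℂ) • c k))).re| ≤
      stokesEigenvalue k * (a k * ‖c k‖) := by
    intro k _
    refine (Complex.abs_re_le_norm _).trans ((norm_inner_le_norm _ _).trans (le_of_eq ?_))
    rw [norm_neg, norm_smul, Complex.norm_real, Real.norm_of_nonneg
      (mul_nonneg (by positivity) (freqNormSq_nonneg k)), stokesEigenvalue, ha]
    ring
  have habs : |∫ x, ⟪f x, laplacian (realTrigPoly S c) x⟫_ℝ| ≤
      ∑ k ∈ S, stokesEigenvalue k * (a k * ‖c k‖) := by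
    rw [hpair]
    exact (Finset.abs_sum_le_sum_abs _ _).trans (Finset.sum_le_sum hterm)
  -- Cauchy–Schwarz
  have hcs : (∑ k ∈ S, stokesEigenvalue k * (a k * ‖c k‖)) ^ 2 ≤
      (∑ k ∈ S, stokesEigenvalue k * a k ^ 2) * ∑ k ∈ S, stokesEigenvalue k * ‖c k‖ ^ 2 :=
    Finset.sum_sq_le_sum_mul_sum_of_sq_le_mul S
      (fun k _ => mul_nonneg (stokesEigenvalue_nonneg k) (sq_nonneg _))
      (fun k _ => mul_nonneg (stokesEigenvalue_nonneg k) (sq_nonneg _))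
      (fun k _ => le_of_eq (by ring))
  have hZ : ∑ k ∈ S, stokesEigenvalue k * ‖c k‖ ^ 2 = (eGradNormSq (realTrigPoly S c)).toReal := by
    rw [toReal_eGradNormSq_realTrigPoly hS hc, Finset.mul_sum]
    exact Finset.sum_congr rfl fun k _ => by rw [stokesEigenvalue]; ring
  have hZ0 : 0 ≤ (eGradNormSq (realTrigPoly S c)).toReal := ENNReal.toReal_nonneg
  have hsum0 : 0 ≤ ∑ k ∈ S, stokesEigenvalue k * (a k * ‖c k‖) :=
    Finset.sum_nonneg fun k _ => mul_nonneg (stokesEigenvalue_nonneg k)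
      (mul_nonneg (norm_nonneg _) (norm_nonneg _))
  calc (∫ x, ⟪f x, laplacian (realTrigPoly S c) x⟫_ℝ) ^ 2
      ≤ (∑ k ∈ S, stokesEigenvalue k * (a k * ‖c k‖)) ^ 2 := sq_le_sq' (by
          have := neg_abs_le (∫ x, ⟪f x, laplacian (realTrigPoly S c) x⟫_ℝ); linarith)
          ((le_abs_self _).trans habs)
    _ ≤ (∑ k ∈ S, stokesEigenvalue k * a k ^ 2) * ∑ k ∈ S, stokesEigenvalue k * ‖c k‖ ^ 2 := hcs
    _ ≤ Zf * (eGradNormSq (realTrigPoly S c)).toReal := by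
        rw [hZ]
        exact mul_le_mul_of_nonneg_right (hZf S) hZ0

/-- From `p² ≤ Z_f Z` to `-2p ≤ Z_f/γ + γZ` (`γ > 0`, `Z_f, Z ≥ 0`). [folklore] -/
theorem neg_two_mul_le_of_sq_le_mul {p Zf Z γ : ℝ} (hγ : 0 < γ) (hZf : 0 ≤ Zf) (hZ : 0 ≤ Z)
    (h : p ^ 2 ≤ Zf * Z) : -(2 * p) ≤ Zf / γ + γ * Z := by
  have hM : 0 ≤ Zf + γ ^ 2 * Z := by positivity
  have hsq : (2 * γ * p) ^ 2 ≤ (Zf + γ ^ 2 * Z) ^ 2 := by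
    nlinarith [sq_nonneg (Zf - γ ^ 2 * Z), sq_nonneg γ]
  have habs := (abs_le_of_sq_le_sq' hsq hM).1
  have hdiv : Zf / γ + γ * Z = (Zf + γ ^ 2 * Z) / γ := by
    field_simp
  rw [hdiv, le_div_iff₀ hγ]
  nlinarith

/-- **The damped enstrophy rate of a Galerkin state.** On `𝕋²`, let `u = realTrigPoly S c` and
`G = realTrigPoly S g_c` be real trigonometric polynomials (`c`, `g_c` conjugate symmetric, `S`
symmetric), `f ∈ L²` with `∑ 4π²|k|²‖f̂ k‖² ≤ Z_f` on finite sets, `ν, γ > 0`, and put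
`E = G - f + γu`. Then the enstrophy rate `-2(ν‖Δu‖₂² + ∫⟪G, Δu⟫)` is at most
`ν⁻¹ ∫‖E‖² + Z_f/γ - γ ‖∇u‖₂²`: write `G = E + f - γu`, and use Young for the `E` term,
Fourier Cauchy–Schwarz for the `f` term and `∫⟪u, Δu⟫ = -‖∇u‖₂²`. [folklore] -/
theorem damped_enstrophy_rate_le {ν γ Zf : ℝ} (hν : 0 < ν) (hγ : 0 < γ) (hZf0 : 0 ≤ Zf)
    {S : Finset (Fin 2 → ℤ)} (hS : ∀ k ∈ S, -k ∈ S)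
    {c : (Fin 2 → ℤ) → EuclideanSpace ℂ (Fin 2)} (hc : IsConjSymm c)
    (gc : (Fin 2 → ℤ) → EuclideanSpace ℂ (Fin 2)) {f : UnitAddTorus (Fin 2) → EuclideanSpace ℝ (Fin 2)} (hf : MemLp f 2 volume)
    (hZf : ∀ S' : Finset (Fin 2 → ℤ), ∑ k ∈ S', stokesEigenvalue k *
      ‖mFourierCoeff (EuclideanSpace.complexify ∘ f) k‖ ^ 2 ≤ Zf) :
    -2 * (ν * (∫ x, ‖laplacian (realTrigPoly S c) x‖ ^ 2) +
        ∫ x, ⟪realTrigPoly S gc x, laplacian (realTrigPoly S c) x⟫_ℝ) ≤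
      ν⁻¹ * (∫ x, ‖realTrigPoly S gc x - f x + γ • realTrigPoly S c x‖ ^ 2) + Zf / γ -
        γ * (eGradNormSq (realTrigPoly S c)).toReal := by
  set U : UnitAddTorus (Fin 2) → EuclideanSpace ℝ (Fin 2) := realTrigPoly S c with hU
  set G : UnitAddTorus (Fin 2) → EuclideanSpace ℝ (Fin 2) := realTrigPoly S gc with hG
  set L : UnitAddTorus (Fin 2) → EuclideanSpace ℝ (Fin 2) := laplacian U with hL
  set E : UnitAddTorus (Fin 2) → EuclideanSpace ℝ (Fin 2) := fun x => G x - f x + γ • U x with hE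
  have hUs : IsSmooth U := isSmooth_realTrigPoly S c
  have hGs : IsSmooth G := isSmooth_realTrigPoly S gc
  have hLs : IsSmooth L := hUs.laplacian
  have hUc : Continuous U := hUs.continuous
  have hGc : Continuous G := hGs.continuous
  have hLc : Continuous L := hLs.continuous
  have hfi : Integrable f volume := hf.integrable one_le_two
  have hEmem : MemLp E 2 volume :=
    ((memLp_realTrigPoly S gc 2).sub hf).add ((memLp_realTrigPoly S c 2).const_smul γ)
  have hEi : Integrable E volume := hEmem.integrable one_le_two
  -- decomposition of the force pairing
  have hGdec : ∀ x, ⟪G x, L x⟫_ℝ = ⟪E x, L x⟫_ℝ + ⟪f x, L x⟫_ℝ - γ * ⟪U x, L x⟫_ℝ := by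
    intro x
    have hx : G x = E x + f x - γ • U x := by rw [hE]; dsimp only; abel
    rw [hx, inner_sub_left, inner_add_left, real_inner_smul_left]
  have hiE : Integrable (fun x => ⟪E x, L x⟫_ℝ) volume := integrable_inner_of_continuous hEi hLc
  have hif : Integrable (fun x => ⟪f x, L x⟫_ℝ) volume := integrable_inner_of_continuous hfi hLc
  have hiU : Integrable (fun x => ⟪U x, L x⟫_ℝ) volume := (hUs.inner hLs).integrable
  have hdec : ∫ x, ⟪G x, L x⟫_ℝ = (∫ x, ⟪E x, L x⟫_ℝ) + (∫ x, ⟪f x, L x⟫_ℝ) - γ * ∫ x, ⟪U x, L x⟫_ℝ := by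
    have h1 : ∫ x, ⟪G x, L x⟫_ℝ = ∫ x, (⟪E x, L x⟫_ℝ + ⟪f x, L x⟫_ℝ - γ * ⟪U x, L x⟫_ℝ) :=
      integral_congr_ae (ae_of_all _ fun x => hGdec x)
    have hiEf : Integrable (fun x => ⟪E x, L x⟫_ℝ + ⟪f x, L x⟫_ℝ) volume := hiE.add hif
    have hiγU : Integrable (fun x => γ * ⟪U x, L x⟫_ℝ) volume := hiU.const_mul γ
    rw [h1, integral_sub hiEf hiγU, integral_add hiE hif, integral_const_mul]
  -- Young for the `E` term
  have hY : -(2 * ∫ x, ⟪E x, L x⟫_ℝ) ≤ ν * (∫ x, ‖L x‖ ^ 2) + ν⁻¹ * ∫ x, ‖E x‖ ^ 2 := by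
    have hiL2 : Integrable (fun x => ‖L x‖ ^ 2) volume := (hLc.norm.pow 2).integrable_unitAddTorus
    have hiE2 : Integrable (fun x => ‖E x‖ ^ 2) volume := hEmem.integrable_norm_pow two_ne_zero
    rw [← integral_const_mul, ← integral_neg, ← integral_const_mul, ← integral_const_mul,
      ← integral_add (hiL2.const_mul ν) (hiE2.const_mul ν⁻¹)]
    refine integral_mono (hiE.const_mul 2).neg ((hiL2.const_mul ν).add (hiE2.const_mul ν⁻¹))
      fun x => ?_
    exact neg_two_mul_inner_le hν (E x) (L x)
  -- Fourier Cauchy–Schwarz for the `f` term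
  have hCS : -(2 * ∫ x, ⟪f x, L x⟫_ℝ) ≤ Zf / γ + γ * (eGradNormSq U).toReal :=
    neg_two_mul_le_of_sq_le_mul hγ hZf0 ENNReal.toReal_nonneg
      (sq_integral_inner_laplacian_realTrigPoly_le hS hc hf hZf)
  -- the damping term
  have hD : ∫ x, ⟪U x, L x⟫_ℝ = -(eGradNormSq U).toReal := integral_inner_laplacian_realTrigPoly_self hS hc
  have hL0 : 0 ≤ ∫ x, ‖L x‖ ^ 2 := integral_nonneg fun x => sq_nonneg _
  rw [hdec, hD]
  nlinarith [hY, hCS, hL0, hν]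

end Rate

/-! ### The damped enstrophy inequality along the Galerkin ODE on `𝕋²` -/

section ODE

variable {S : Finset (Fin 2 → ℤ)}

/-- The space–time lift of a steady continuous field is continuous. [folklore] -/
theorem continuous_stLift_const {d : Type*} [Fintype d] {F : Type*} [TopologicalSpace F]
    {f : UnitAddTorus d → F} (hf : Continuous f) : Continuous (stLift fun _ : ℝ => f) :=
  hf.comp (continuous_proj.comp continuous_snd)

/-- **The damped enstrophy inequality of 2-D Galerkin solutions.** Let `α` solve the Galerkin
ODE of order `S` (symmetric) on every `[0, T]` in the Galerkin phase space of `𝕋²`, driven by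
continuous real force coefficients `g`, continuous on `[0, ∞)`; put
`u(τ) = realTrigPoly S ᾱ(τ)`, `G(τ) = realTrigPoly S ḡ(τ)`. Let `f` be continuous with
`∑ 4π²|k|²‖f̂ k‖² ≤ Z_f` on finite sets, `ν, γ > 0`. Then for `0 ≤ s ≤ t`,
`‖∇u(t)‖₂² + γ∫ₛᵗ‖∇u‖₂² ≤ ‖∇u(s)‖₂² + ν⁻¹∫ₛᵗ∫‖G - f + γu‖² + (t - s) Z_f/γ`
(the enstrophy identity `d/dt‖∇u‖² = -2(ν‖Δu‖² + ∫⟪G,Δu⟫)` of the 2-D Galerkin system,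
`hasDerivWithinAt_toReal_eGradNormSq_fin_two`, closed by `damped_enstrophy_rate_le` and
integrated on `[s, t]`). This is the Galerkin-level form of the damped–driven enstrophy balance
of Constantin–Ramos 2007, §2, written for the frozen force `G ≈ f - γu`. [cite: ConstantinRamos2007, §2 (enstrophy balance of the damped and driven equations)] -/
theorem galerkin_damped_enstrophy_ineq {ν γ Zf : ℝ} (hν : 0 < ν) (hγ : 0 < γ) (hZf0 : 0 ≤ Zf)
    (hS : ∀ k ∈ S, -k ∈ S) {g : ℝ → ↥S → EuclideanSpace ℂ (Fin 2)} (hg : Continuous g)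
    (hgr : ∀ t, IsRealCoeff (g t)) {α : ℝ → ↥S → EuclideanSpace ℂ (Fin 2)}
    (hmem : ∀ t, α t ∈ galerkinSubspace S) (hαc : ContinuousOn α (Ici 0))
    (hα : ∀ T, ∀ t ∈ Icc 0 T, HasDerivWithinAt α (galerkinRHS S ν (g t) (α t)) (Icc 0 T) t)
    {f : UnitAddTorus (Fin 2) → EuclideanSpace ℝ (Fin 2)} (hf : Continuous f)
    (hZf : ∀ S' : Finset (Fin 2 → ℤ), ∑ k ∈ S', stokesEigenvalue k *
      ‖mFourierCoeff (EuclideanSpace.complexify ∘ f) k‖ ^ 2 ≤ Zf)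
    {s t : ℝ} (hs : 0 ≤ s) (hst : s ≤ t) :
    (eGradNormSq (realTrigPoly S (coeffExt S (α t)))).toReal +
        γ * ∫ τ in s..t, (eGradNormSq (realTrigPoly S (coeffExt S (α τ)))).toReal ≤
      (eGradNormSq (realTrigPoly S (coeffExt S (α s)))).toReal +
        ν⁻¹ * (∫ τ in s..t, ∫ x, ‖realTrigPoly S (coeffExt S (g τ)) x - f x +
          γ • realTrigPoly S (coeffExt S (α τ)) x‖ ^ 2) + (t - s) * Zf / γ := by
  -- names
  obtain ⟨E₁, hE₁⟩ : ∃ E : ℝ → ℝ,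
      E = fun τ => (eGradNormSq (realTrigPoly S (coeffExt S (α τ)))).toReal := ⟨_, rfl⟩
  obtain ⟨E₂, hE₂⟩ : ∃ E : ℝ → ℝ,
      E = fun τ => ∫ x, ‖laplacian (realTrigPoly S (coeffExt S (α τ))) x‖ ^ 2 := ⟨_, rfl⟩
  obtain ⟨P, hP⟩ : ∃ P : ℝ → ℝ, P = fun τ => ∫ x, ⟪realTrigPoly S (coeffExt S (g τ)) x,
      laplacian (realTrigPoly S (coeffExt S (α τ))) x⟫_ℝ := ⟨_, rfl⟩
  obtain ⟨Q, hQ⟩ : ∃ Q : ℝ → ℝ, Q = fun τ => ∫ x, ‖realTrigPoly S (coeffExt S (g τ)) x - f x +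
      γ • realTrigPoly S (coeffExt S (α τ)) x‖ ^ 2 := ⟨_, rfl⟩
  have hderiv : ∀ T, ∀ τ ∈ Icc 0 T, HasDerivWithinAt E₁ (-2 * (ν * E₂ τ + P τ)) (Icc 0 T) τ := by
    intro T τ hτ
    subst hE₁ hE₂ hP
    exact hasDerivWithinAt_toReal_eGradNormSq_fin_two ν hS (hα T τ hτ) hmem (hgr τ)
  -- the pointwise bound on the rate
  have hrate : ∀ τ, -2 * (ν * E₂ τ + P τ) ≤ ν⁻¹ * Q τ + Zf / γ - γ * E₁ τ := by
    intro τ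
    subst hE₁ hE₂ hP hQ
    exact damped_enstrophy_rate_le hν hγ hZf0 hS ((hmem τ).1.isConjSymm_coeffExt hS)
      (coeffExt S (g τ)) (hf.memLp_of_hasCompactSupport (HasCompactSupport.of_compactSpace f)) hZf
  -- continuity on `[0, t]`
  have hα_cont : ContinuousOn α (Icc 0 t) := fun τ hτ => (hα t τ hτ).continuousWithinAt
  have hE₁_cont : ContinuousOn E₁ (Icc 0 t) := by
    subst hE₁; exact continuousOn_toReal_eGradNormSq_galerkin hS hα_cont fun τ _ => (hmem τ).1
  have hE₂_cont : ContinuousOn E₂ (Icc 0 t) := by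
    subst hE₂; exact continuousOn_integral_norm_sq_laplacian_galerkin hS hmem hα_cont
  have hP_cont : ContinuousOn P (Icc 0 t) := by
    have hP_eq : ∀ τ, P τ = ∑ k : ↥S, (inner ℂ (g τ k)
        (-(((4 * Real.pi ^ 2 * freqNormSq (k : Fin 2 → ℤ) : ℝ) : ℂ) • α τ k))).re := by
      intro τ; subst hP
      exact integral_inner_realTrigPoly_laplacian_eq_sum hS (hgr τ) (hmem τ).1
    rw [funext hP_eq]
    refine continuousOn_finsetSum _ fun k _ => Complex.continuous_re.comp_continuousOn ?_
    refine ((continuous_apply k).comp_continuousOn (hg.continuousOn (s := Icc 0 t))).inner ?_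
    exact (((continuous_apply k).comp_continuousOn hα_cont).const_smul
      (((4 * Real.pi ^ 2 * freqNormSq (k : Fin 2 → ℤ) : ℝ) : ℂ))).neg
  -- the space–time lift of `E = G - f + γu` is continuous on `[0, ∞) × (EuclideanSpace ℝ (Fin 2))`
  have hElift : ContinuousOn (stLift fun τ x => realTrigPoly S (coeffExt S (g τ)) x - f x +
      γ • realTrigPoly S (coeffExt S (α τ)) x) (Ici 0 ×ˢ univ) := by
    have hGl : ContinuousOn (stLift fun τ => realTrigPoly S (coeffExt S (g τ))) (Ici 0 ×ˢ univ) :=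
      continuousOn_stLift_realTrigPoly hg.continuousOn
    have hUl : ContinuousOn (stLift fun τ => realTrigPoly S (coeffExt S (α τ))) (Ici 0 ×ˢ univ) :=
      continuousOn_stLift_realTrigPoly hαc
    have hfl : ContinuousOn (stLift fun _ : ℝ => f) (Ici 0 ×ˢ univ) := (continuous_stLift_const hf).continuousOn
    have heq : (stLift fun τ x => realTrigPoly S (coeffExt S (g τ)) x - f x +
        γ • realTrigPoly S (coeffExt S (α τ)) x) = fun p =>
        stLift (fun τ => realTrigPoly S (coeffExt S (g τ))) p - stLift (fun _ : ℝ => f) p +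
          γ • stLift (fun τ => realTrigPoly S (coeffExt S (α τ))) p := by
      rfl
    rw [heq]
    exact (hGl.sub hfl).add (hUl.const_smul γ)
  have hQ_cont : ContinuousOn Q (Icc 0 t) := by
    subst hQ
    exact (continuousOn_integral_norm_sq_of_continuousOn_stLift hElift).mono fun τ hτ => mem_Ici.2 hτ.1
  -- interval integrability on `[s, t]`
  have hsub : Icc s t ⊆ Icc 0 t := Icc_subset_Icc hs le_rfl
  have huIcc : uIcc s t ⊆ Icc 0 t := by rw [uIcc_of_le hst]; exact hsub
  have hE₁_int : IntervalIntegrable E₁ volume s t := (hE₁_cont.mono huIcc).intervalIntegrable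
  have hE₂_int : IntervalIntegrable E₂ volume s t := (hE₂_cont.mono huIcc).intervalIntegrable
  have hP_int : IntervalIntegrable P volume s t := (hP_cont.mono huIcc).intervalIntegrable
  have hQ_int : IntervalIntegrable Q volume s t := (hQ_cont.mono huIcc).intervalIntegrable
  have hD_int : IntervalIntegrable (fun τ => -2 * (ν * E₂ τ + P τ)) volume s t :=
    ((hE₂_int.const_mul ν).add hP_int).const_mul (-2)
  have hR_int : IntervalIntegrable (fun τ => ν⁻¹ * Q τ + Zf / γ - γ * E₁ τ) volume s t :=
    ((hQ_int.const_mul ν⁻¹).add intervalIntegrable_const).sub (hE₁_int.const_mul γ)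
  -- FTC on `[s, t]`
  have hFTC : ∫ τ in s..t, -2 * (ν * E₂ τ + P τ) = E₁ t - E₁ s := by
    refine intervalIntegral.integral_eq_sub_of_hasDeriv_right_of_le hst ?_ ?_ hD_int
    · exact fun τ hτ => ((hderiv t τ (hsub hτ)).continuousWithinAt).mono hsub
    · intro τ hτ
      have h := hderiv t τ ⟨hs.trans hτ.1.le, hτ.2.le⟩
      exact (h.hasDerivAt (Icc_mem_nhds (hs.trans_lt hτ.1) hτ.2)).hasDerivWithinAt
  -- integrate the pointwise bound
  have hmono : ∫ τ in s..t, -2 * (ν * E₂ τ + P τ) ≤ ∫ τ in s..t, (ν⁻¹ * Q τ + Zf / γ - γ * E₁ τ) :=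
    intervalIntegral.integral_mono_on hst hD_int hR_int fun τ _ => hrate τ
  have hsplit : ∫ τ in s..t, (ν⁻¹ * Q τ + Zf / γ - γ * E₁ τ) =
      ν⁻¹ * (∫ τ in s..t, Q τ) + (t - s) * (Zf / γ) - γ * ∫ τ in s..t, E₁ τ := by
    rw [intervalIntegral.integral_sub ((hQ_int.const_mul ν⁻¹).add intervalIntegrable_const)
        (hE₁_int.const_mul γ),
      intervalIntegral.integral_add (hQ_int.const_mul ν⁻¹) intervalIntegrable_const,
      intervalIntegral.integral_const_mul, intervalIntegral.integral_const_mul,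
      intervalIntegral.integral_const, smul_eq_mul]
  rw [hFTC, hsplit] at hmono
  have hE₁t : (eGradNormSq (realTrigPoly S (coeffExt S (α t)))).toReal = E₁ t := by rw [hE₁]
  have hE₁s : (eGradNormSq (realTrigPoly S (coeffExt S (α s)))).toReal = E₁ s := by rw [hE₁]
  have hIE : ∫ τ in s..t, (eGradNormSq (realTrigPoly S (coeffExt S (α τ)))).toReal = ∫ τ in s..t, E₁ τ := by
    rw [hE₁]
  have hIQ : (∫ τ in s..t, ∫ x, ‖realTrigPoly S (coeffExt S (g τ)) x - f x +
      γ • realTrigPoly S (coeffExt S (α τ)) x‖ ^ 2) = ∫ τ in s..t, Q τ := by rw [hQ]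
  rw [hE₁t, hE₁s, hIE, hIQ]
  have : (t - s) * Zf / γ = (t - s) * (Zf / γ) := by ring
  rw [this]
  linarith

/-- **The damped enstrophy inequality, `ℝ≥0∞` form with space–time `lintegral`s.** Under the
hypotheses of `galerkin_damped_enstrophy_ineq`, for `0 ≤ s ≤ t`,
`γ (∫⁻_{(s,t)} ‖∇u‖₂²).toReal ≤ ‖∇u(s)‖₂² + ν⁻¹ (∫⁻_{(s,t)} ∫⁻ ‖G - f + γu‖ₑ²).toReal + (t-s)Z_f/γ`,
both `lintegral`s being finite. [cite: ConstantinRamos2007, §2 (enstrophy balance of the damped and driven equations)] -/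
theorem galerkin_damped_enstrophy_ineq_lintegral {ν γ Zf : ℝ} (hν : 0 < ν) (hγ : 0 < γ)
    (hZf0 : 0 ≤ Zf) (hS : ∀ k ∈ S, -k ∈ S) {g : ℝ → ↥S → EuclideanSpace ℂ (Fin 2)}
    (hg : Continuous g) (hgr : ∀ t, IsRealCoeff (g t)) {α : ℝ → ↥S → EuclideanSpace ℂ (Fin 2)}
    (hmem : ∀ t, α t ∈ galerkinSubspace S) (hαc : ContinuousOn α (Ici 0))
    (hα : ∀ T, ∀ t ∈ Icc 0 T, HasDerivWithinAt α (galerkinRHS S ν (g t) (α t)) (Icc 0 T) t)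
    {f : UnitAddTorus (Fin 2) → EuclideanSpace ℝ (Fin 2)} (hf : Continuous f)
    (hZf : ∀ S' : Finset (Fin 2 → ℤ), ∑ k ∈ S', stokesEigenvalue k *
      ‖mFourierCoeff (EuclideanSpace.complexify ∘ f) k‖ ^ 2 ≤ Zf)
    {s t : ℝ} (hs : 0 ≤ s) (hst : s ≤ t) :
    γ * (∫⁻ τ in Ioo s t, eGradNormSq (realTrigPoly S (coeffExt S (α τ)))).toReal ≤
      (eGradNormSq (realTrigPoly S (coeffExt S (α s)))).toReal +
        ν⁻¹ * (∫⁻ τ in Ioo s t, ∫⁻ x, ‖realTrigPoly S (coeffExt S (g τ)) x - f x +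
          γ • realTrigPoly S (coeffExt S (α τ)) x‖ₑ ^ 2).toReal + (t - s) * Zf / γ := by
  have h := galerkin_damped_enstrophy_ineq hν hγ hZf0 hS hg hgr hmem hαc hα hf hZf hs hst
  -- the enstrophy integral as a `lintegral`
  have hα_cont : ContinuousOn α (Icc s t) := fun τ hτ =>
    (hα t τ ⟨hs.trans hτ.1, hτ.2⟩).continuousWithinAt.mono (Icc_subset_Icc hs le_rfl)
  have hZc : ContinuousOn (fun τ => (eGradNormSq (realTrigPoly S (coeffExt S (α τ)))).toReal) (Icc s t) :=
    continuousOn_toReal_eGradNormSq_galerkin hS hα_cont fun τ _ => (hmem τ).1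
  have hZeq : ∫ τ in s..t, (eGradNormSq (realTrigPoly S (coeffExt S (α τ)))).toReal =
      (∫⁻ τ in Ioo s t, eGradNormSq (realTrigPoly S (coeffExt S (α τ)))).toReal := by
    rw [intervalIntegral_eq_toReal_lintegral hst hZc (fun τ _ => ENNReal.toReal_nonneg)]
    congr 1
    refine setLIntegral_congr_fun measurableSet_Ioo fun τ _ => ?_
    rw [eGradNormSq_coeffExt hS (hmem τ).1, ENNReal.toReal_ofReal]
    exact mul_nonneg (by positivity) (Finset.sum_nonneg fun k _ =>
      mul_nonneg (freqNormSq_nonneg _) (sq_nonneg _))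
  -- the error integral as a `lintegral`
  have hElift : ContinuousOn (stLift fun τ x => realTrigPoly S (coeffExt S (g τ)) x - f x +
      γ • realTrigPoly S (coeffExt S (α τ)) x) (Ici 0 ×ˢ univ) := by
    have hGl : ContinuousOn (stLift fun τ => realTrigPoly S (coeffExt S (g τ))) (Ici 0 ×ˢ univ) :=
      continuousOn_stLift_realTrigPoly hg.continuousOn
    have hUl : ContinuousOn (stLift fun τ => realTrigPoly S (coeffExt S (α τ))) (Ici 0 ×ˢ univ) :=
      continuousOn_stLift_realTrigPoly hαc
    have hfl : ContinuousOn (stLift fun _ : ℝ => f) (Ici 0 ×ˢ univ) := (continuous_stLift_const hf).continuousOn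
    have heq : (stLift fun τ x => realTrigPoly S (coeffExt S (g τ)) x - f x +
        γ • realTrigPoly S (coeffExt S (α τ)) x) = fun p =>
        stLift (fun τ => realTrigPoly S (coeffExt S (g τ))) p - stLift (fun _ : ℝ => f) p +
          γ • stLift (fun τ => realTrigPoly S (coeffExt S (α τ))) p := by
      rfl
    rw [heq]
    exact (hGl.sub hfl).add (hUl.const_smul γ)
  obtain ⟨-, hQeq⟩ := intervalIntegral_norm_sq_eq_toReal hElift hs hst
  have h0 : 0 ≤ (eGradNormSq (realTrigPoly S (coeffExt S (α t)))).toReal := ENNReal.toReal_nonneg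
  rw [hZeq, hQeq] at h
  linarith

end ODE

/-! ## Part C. The interior time-integrated enstrophy bound of the damped–driven flow -/

section Interior

/-- `‖a + γ • b‖ₑ² ≤ 2‖a‖ₑ² + 2‖γ‖ₑ²‖b‖ₑ²`. [folklore] -/
theorem enorm_add_smul_sq_le {E : Type*} [NormedAddCommGroup E] [NormedSpace ℝ E] (a b : E) (γ : ℝ) :
    ‖a + γ • b‖ₑ ^ 2 ≤ 2 * ‖a‖ₑ ^ 2 + 2 * (‖γ‖ₑ ^ 2 * ‖b‖ₑ ^ 2) := by
  have h := enorm_sq_le_two_mul_add (a + γ • b) a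
  rw [add_sub_cancel_left, enorm_smul, mul_pow] at h
  rwa [add_comm (2 * (‖γ‖ₑ ^ 2 * ‖b‖ₑ ^ 2))] at h

/-- The space–time lift of a global Leray–Hopf solution on the torus is a.e.-strongly
measurable on `(0, ∞) × ℝ^d` (from the slabs `(0, n) × ℝ^d`). [folklore] -/
theorem Torus.IsGlobalLerayHopf.aestronglyMeasurable_stLift {d : Type*} [Fintype d] [DecidableEq d]
    {ν : ℝ} {F : ℝ → UnitAddTorus d → EuclideanSpace ℝ d} {u₀ : UnitAddTorus d → EuclideanSpace ℝ d}
    {u : ℝ → UnitAddTorus d → EuclideanSpace ℝ d} (hu : Torus.IsGlobalLerayHopf ν F u₀ u) :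
    AEStronglyMeasurable (stLift u) (volume.restrict (Ioi 0 ×ˢ univ)) := by
  rw [Ioi_zero_eq_iUnion_Ioo_nat, iUnion_prod_const, aestronglyMeasurable_iUnion_iff]
  intro n
  rcases Nat.eq_zero_or_pos n with hn | hn
  · subst hn
    simp
  · exact (hu n (by exact_mod_cast hn)).weak.1

/-- **The frozen force of the damped–driven system is an admissible Leray–Hopf force.** For a
global Leray–Hopf solution `u` of the system with force `f - γu` (`f` continuous), the frozen
force `F(t, x) = f(x) - γ u(t, x)` is space–time measurable on `(0, ∞) × ℝ²` and square integrable
on every `(0, T) × 𝕋²`. [folklore] -/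
theorem frozenForce_admissible {d : Type*} [Fintype d] [DecidableEq d] {ν γ : ℝ}
    {f : UnitAddTorus d → EuclideanSpace ℝ d} (hf : Continuous f)
    {u₀ : UnitAddTorus d → EuclideanSpace ℝ d} {u : ℝ → UnitAddTorus d → EuclideanSpace ℝ d}
    (hu : Torus.IsGlobalLerayHopf ν (fun t x => f x - γ • u t x) u₀ u) :
    AEStronglyMeasurable (stLift fun t x => f x - γ • u t x) (volume.restrict (Ioi 0 ×ˢ univ)) ∧
      ∀ T, 0 < T → ∫⁻ t in Ioo 0 T, ∫⁻ x, ‖f x - γ • u t x‖ₑ ^ 2 < ⊤ := by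
  have hum := hu.aestronglyMeasurable_stLift
  refine ⟨?_, fun T hT => ?_⟩
  · have heq : (stLift fun t x => f x - γ • u t x) =
        fun p => stLift (fun _ : ℝ => f) p - γ • stLift u p := rfl
    rw [heq]
    exact (continuous_stLift_const hf).aestronglyMeasurable.sub (hum.const_smul γ)
  · -- `‖f - γu‖ₑ² ≤ 2‖f‖ₑ² + 2γ²‖u‖ₑ²`, `f` bounded, `u ∈ L²ₜₓ`
    have hu2 : ∫⁻ t in Ioo 0 T, ∫⁻ x, ‖u t x‖ₑ ^ 2 < ⊤ := (hu T hT).weak.2.1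
    obtain ⟨C, hC⟩ := (isCompact_univ.image hf).isBounded.exists_norm_le
    have hC' : ∀ x, ‖f x‖ ≤ C := fun x => hC _ ⟨x, mem_univ _, rfl⟩
    have hfx : ∀ x, ‖f x‖ₑ ^ 2 ≤ ENNReal.ofReal (C ^ 2) := fun x => by
      rw [← ofReal_norm, ← ENNReal.ofReal_pow (norm_nonneg _)]
      exact ENNReal.ofReal_le_ofReal (pow_le_pow_left₀ (norm_nonneg _) (hC' x) 2)
    have hpt : ∀ t x, ‖f x - γ • u t x‖ₑ ^ 2 ≤
        2 * ENNReal.ofReal (C ^ 2) + 2 * (‖γ‖ₑ ^ 2 * ‖u t x‖ₑ ^ 2) := by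
      intro t x
      have h := enorm_add_smul_sq_le (f x) (u t x) (-γ)
      rw [neg_smul, ← sub_eq_add_neg, enorm_neg] at h
      refine h.trans ?_
      gcongr
      exact hfx x
    have hmeas : AEMeasurable (fun _ : UnitAddTorus d => 2 * ENNReal.ofReal (C ^ 2)) volume :=
      aemeasurable_const
    have hγtop : (2 : ℝ≥0∞) * ‖γ‖ₑ ^ 2 ≠ ⊤ :=
      ENNReal.mul_ne_top ENNReal.ofNat_ne_top (ENNReal.pow_ne_top enorm_ne_top)
    calc ∫⁻ t in Ioo 0 T, ∫⁻ x, ‖f x - γ • u t x‖ₑ ^ 2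
        ≤ ∫⁻ t in Ioo 0 T, ∫⁻ x, (2 * ENNReal.ofReal (C ^ 2) + 2 * (‖γ‖ₑ ^ 2 * ‖u t x‖ₑ ^ 2)) :=
          lintegral_mono fun t => lintegral_mono fun x => hpt t x
      _ = ∫⁻ t in Ioo 0 T, (2 * ENNReal.ofReal (C ^ 2) + 2 * ‖γ‖ₑ ^ 2 * ∫⁻ x, ‖u t x‖ₑ ^ 2) := by
          refine lintegral_congr fun t => ?_
          rw [lintegral_add_left' hmeas, lintegral_const, measure_univ, mul_one,
            lintegral_const_mul' _ _ ENNReal.ofNat_ne_top,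
            lintegral_const_mul' _ _ (ENNReal.pow_ne_top enorm_ne_top), ← mul_assoc]
      _ = (∫⁻ _ in Ioo 0 T, 2 * ENNReal.ofReal (C ^ 2)) +
            2 * ‖γ‖ₑ ^ 2 * ∫⁻ t in Ioo 0 T, ∫⁻ x, ‖u t x‖ₑ ^ 2 := by
          rw [lintegral_add_left' aemeasurable_const,
            lintegral_const_mul' (2 * ‖γ‖ₑ ^ 2) (fun t => ∫⁻ x, ‖u t x‖ₑ ^ 2) hγtop]
      _ < ⊤ := by
          rw [setLIntegral_const]
          exact ENNReal.add_lt_top.2 ⟨ENNReal.mul_lt_top (ENNReal.mul_lt_top (by simp)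
            ENNReal.ofReal_lt_top) measure_Ioo_lt_top,
            ENNReal.mul_lt_top (lt_top_iff_ne_top.2 hγtop) hu2⟩

/-- **First-moment selection.** If `∫⁻_{(0,σ)} Z ≤ ofReal C` with `σ > 0`, `C ≥ 0`, then
`Z s ≤ (C + 1)/σ` at some `s ∈ (0, σ)`. [folklore] -/
theorem exists_mem_Ioo_le_of_lintegral_le {Z : ℝ → ℝ≥0∞} {σ C : ℝ} (hσ : 0 < σ) (hC : 0 ≤ C)
    (h : ∫⁻ s in Ioo 0 σ, Z s ≤ ENNReal.ofReal C) :
    ∃ s ∈ Ioo 0 σ, Z s ≤ ENNReal.ofReal ((C + 1) / σ) := by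
  by_contra hcon
  push Not at hcon
  have h1 : ∫⁻ _ in Ioo 0 σ, ENNReal.ofReal ((C + 1) / σ) ≤ ∫⁻ s in Ioo 0 σ, Z s :=
    setLIntegral_mono' measurableSet_Ioo fun s hs => (hcon s hs).le
  rw [setLIntegral_const, Real.volume_Ioo, sub_zero, ← ENNReal.ofReal_mul (by positivity),
    div_mul_cancel₀ _ hσ.ne'] at h1
  have h2 := (ENNReal.ofReal_le_ofReal_iff hC).1 (h1.trans h)
  linarith

/-- **The interior time-integrated enstrophy bound of the damped–driven 2-D flow, uniformly in
the viscosity** (the enstrophy bound of Constantin–Ramos 2007, §2, Thm. 2.1 — "the enstrophy is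
bounded uniformly in time, with bounds independent of viscosity", from the enstrophy balance of
`∂ₜω + u·∇ω - νΔω + γω = g` — in time-integrated form and for `L²` data, on the torus). Let
`ν, γ > 0`, `f` Lipschitz with constant `K` on `𝕋²`, `u₀ ∈ L²` weakly divergence free, and let
`u` be a global Leray–Hopf solution with force `f - γu`. Then for every `σ > 0` there is `C`
(depending on everything, including `ν`) such that for all `t ≥ σ`,
`∫_σ^t ‖∇u‖₂² ≤ C + t · (2K²)/γ²` — the growth rate `2K²/γ² ≥ ‖∇f‖₂²/γ²` is independent of
`ν` and of the data. Proof: the Galerkin approximations of the Navier–Stokes problem with the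
FROZEN force `F = f - γu` obey the damped enstrophy inequality
(`galerkin_damped_enstrophy_ineq_lintegral`) with error `∫∫‖G_n - f + γU_n‖² =
∫∫‖(G_n - F) + γ(U_n - u)‖² → 0` along the subsequence of `exists_limitField`
(`tendsto_force`, `tendsto_lintegral_enorm_sub_sq`, and `u = ` the limit a.e. by 2-D
uniqueness `lions_prodi_uniqueness_torus2_holds`); the enstrophy at the initial time of the
inequality is controlled by the energy bound through a first-moment selection in `(0, σ)`, and
Fatou in time passes the bound to the limit. [cite: ConstantinRamos2007, §2 Thm 2.1 (uniform enstrophy bound, independent of viscosity)] -/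
theorem damped_enstrophy_integral_bound {ν γ : ℝ} (hν : 0 < ν) (hγ : 0 < γ)
    {f : UnitAddTorus (Fin 2) → EuclideanSpace ℝ (Fin 2)} {K : ℝ≥0} (hf : LipschitzWith K f)
    {u₀ : UnitAddTorus (Fin 2) → EuclideanSpace ℝ (Fin 2)} (hu₀ : MemLp u₀ 2 volume)
    (hu₀div : FunctionSpaces.Torus.IsWeaklyDivFree u₀)
    {u : ℝ → UnitAddTorus (Fin 2) → EuclideanSpace ℝ (Fin 2)} (hu : Torus.IsGlobalLerayHopf ν (fun t x => f x - γ • u t x) u₀ u)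
    {σ : ℝ} (hσ : 0 < σ) :
    ∃ C : ℝ, 0 ≤ C ∧ ∀ t, σ ≤ t →
      ∫⁻ τ in Ioo σ t, eGradNormSq (u τ) ≤ ENNReal.ofReal (C + t * (2 * (K : ℝ) ^ 2) / γ ^ 2) := by
  have hfc : Continuous f := hf.continuous
  obtain ⟨hFm, hF2⟩ := frozenForce_admissible hfc hu
  set F : ℝ → UnitAddTorus (Fin 2) → EuclideanSpace ℝ (Fin 2) := fun t x => f x - γ • u t x with hFdef
  -- the enstrophy of the force
  set Zf : ℝ := 2 * (K : ℝ) ^ 2 with hZfdef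
  have hZf0 : 0 ≤ Zf := by positivity
  have hZf : ∀ S' : Finset (Fin 2 → ℤ), ∑ k ∈ S', stokesEigenvalue k *
      ‖mFourierCoeff (EuclideanSpace.complexify ∘ f) k‖ ^ 2 ≤ Zf := fun S' => by
    have h := sum_stokesEigenvalue_mul_norm_sq_le_of_lipschitz hf S'
    rwa [Fintype.card_fin, Nat.cast_ofNat] at h
  -- the Hopf–Galerkin scheme for the frozen force, with its coefficient curves
  obtain ⟨g, α, hg, hgr, -, hαmem, hαc, hαd, hGS⟩ :=
    exists_hopfGalerkinScheme_coeffs ν hν u₀ hu₀ hu₀div F hFm hF2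
  -- its Leray–Hopf limit along a subsequence, and `u = v` a.e. by 2-D uniqueness
  obtain ⟨φ, hφ, v, hvm, hv2, hc⟩ := hGS.exists_limitField hν.le hu₀ hFm hF2
  have hGS' := hGS.comp_strictMono hφ
  have hv : Torus.IsGlobalLerayHopf ν F u₀ v := fun T hT =>
    hGS'.isLerayHopfOn_limit hν hu₀ hu₀div hFm hF2 hvm hv2 hc hT
  have hae : ∀ t, 0 < t → u t =ᵐ[volume] v t := fun t ht =>
    lions_prodi_uniqueness_torus2_holds.global hν hFm hF2 hu₀ hu₀div hu hv ht
  -- energy: uniform dissipation bound on `(0, σ)`, and the first-moment selection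
  obtain ⟨A, hA, hFA⟩ := hGS.exists_force_bound hFm hF2 hσ
  set Cσ : ℝ := ((∫ x, ‖u₀ x‖ ^ 2) + 2 * σ * A.toReal) / ν with hCσ
  have hCσ0 : 0 ≤ Cσ := by positivity
  have hDσ : ∀ n, ∫⁻ t in Ioo 0 σ, eGradNormSq (realTrigPoly (freqBall n) (coeffExt (freqBall n) (α n t))) ≤
      ENNReal.ofReal Cσ := fun n => hGS.lintegral_eGradNormSq_le hν hu₀ hσ hA n (hFA n)
  have hsel : ∀ n, ∃ s ∈ Ioo 0 σ,
      eGradNormSq (realTrigPoly (freqBall n) (coeffExt (freqBall n) (α n s))) ≤ ENNReal.ofReal ((Cσ + 1) / σ) :=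
    fun n => exists_mem_Ioo_le_of_lintegral_le hσ hCσ0 (hDσ n)
  choose sn hsn hZsn using hsel
  set Bσ : ℝ := (Cσ + 1) / σ with hBσ
  have hBσ0 : 0 ≤ Bσ := by positivity
  -- names for the approximations and the error field
  set Un : ℕ → ℝ → UnitAddTorus (Fin 2) → EuclideanSpace ℝ (Fin 2) :=
    fun n t => realTrigPoly (freqBall n) (coeffExt (freqBall n) (α n t)) with hUn
  set Gn : ℕ → ℝ → UnitAddTorus (Fin 2) → EuclideanSpace ℝ (Fin 2) :=
    fun n t => realTrigPoly (freqBall n) (coeffExt (freqBall n) (g n t)) with hGn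
  set W : ℕ → ℝ → ℝ≥0∞ := fun n t => ∫⁻ τ in Ioo 0 t, ∫⁻ x, ‖Gn n τ x - f x + γ • Un n τ x‖ₑ ^ 2 with hW
  have hSsym : ∀ n : ℕ, ∀ k ∈ freqBall (d := Fin 2) n, -k ∈ freqBall n := fun n => neg_mem_freqBall_of_mem
  -- the error lift is continuous, so `W n t < ⊤`
  have hElift : ∀ n, ContinuousOn (stLift fun τ x => Gn n τ x - f x + γ • Un n τ x) (Ici 0 ×ˢ univ) := by
    intro n
    have hGl : ContinuousOn (stLift (Gn n)) (Ici 0 ×ˢ univ) := continuousOn_stLift_realTrigPoly (hg n).continuousOn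
    have hUl : ContinuousOn (stLift (Un n)) (Ici 0 ×ˢ univ) := continuousOn_stLift_realTrigPoly (hαc n)
    have hfl : ContinuousOn (stLift fun _ : ℝ => f) (Ici 0 ×ˢ univ) := (continuous_stLift_const hfc).continuousOn
    have heq : (stLift fun τ x => Gn n τ x - f x + γ • Un n τ x) = fun p =>
        stLift (Gn n) p - stLift (fun _ : ℝ => f) p + γ • stLift (Un n) p := rfl
    rw [heq]
    exact (hGl.sub hfl).add (hUl.const_smul γ)
  have hWfin : ∀ n t, 0 ≤ t → W n t < ⊤ := fun n t ht =>
    (intervalIntegral_norm_sq_eq_toReal (hElift n) le_rfl ht).1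
  -- (H) the damped enstrophy inequality from `sn n`, trimmed to `(σ, t)`
  have hH : ∀ n t, σ ≤ t →
      ∫⁻ τ in Ioo σ t, eGradNormSq (Un n τ) ≤
        ENNReal.ofReal ((Bσ + ν⁻¹ * (W n t).toReal + t * Zf / γ) / γ) := by
    intro n t ht
    have hst : sn n ≤ t := (hsn n).2.le.trans ht
    have hineq := galerkin_damped_enstrophy_ineq_lintegral hν hγ hZf0 (hSsym n) (hg n) (hgr n)
      (hαmem n) (hαc n) (hαd n) hfc hZf (hsn n).1.le hst
    -- trim the enstrophy integral to `(σ, t)` and enlarge the error integral to `(0, t)`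
    have hfinZ : ∫⁻ τ in Ioo (sn n) t, eGradNormSq (Un n τ) < ⊤ :=
      lt_of_le_of_lt (lintegral_mono_set (Ioo_subset_Ioo (hsn n).1.le le_rfl))
        (hGS.lintegral_eGradNormSq_lt_top n t)
    have hmonoZ : (∫⁻ τ in Ioo σ t, eGradNormSq (Un n τ)).toReal ≤
        (∫⁻ τ in Ioo (sn n) t, eGradNormSq (Un n τ)).toReal :=
      ENNReal.toReal_mono hfinZ.ne (lintegral_mono_set (Ioo_subset_Ioo (hsn n).2.le le_rfl))
    have hmonoW : (∫⁻ τ in Ioo (sn n) t, ∫⁻ x, ‖Gn n τ x - f x + γ • Un n τ x‖ₑ ^ 2).toReal ≤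
        (W n t).toReal :=
      ENNReal.toReal_mono (hWfin n t ((hsn n).1.le.trans hst)).ne
        (lintegral_mono_set (Ioo_subset_Ioo (hsn n).1.le le_rfl))
    have hZs : (eGradNormSq (Un n (sn n))).toReal ≤ Bσ := ENNReal.toReal_le_of_le_ofReal hBσ0 (hZsn n)
    have hlin : (t - sn n) * Zf / γ ≤ t * Zf / γ :=
      div_le_div_of_nonneg_right (mul_le_mul_of_nonneg_right (by linarith [(hsn n).1]) hZf0) hγ.le
    have hfinσ : ∫⁻ τ in Ioo σ t, eGradNormSq (Un n τ) < ⊤ :=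
      lt_of_le_of_lt (lintegral_mono_set (Ioo_subset_Ioo (hsn n).2.le le_rfl)) hfinZ
    have hreal : γ * (∫⁻ τ in Ioo σ t, eGradNormSq (Un n τ)).toReal ≤
        Bσ + ν⁻¹ * (W n t).toReal + t * Zf / γ := by
      have h1 := mul_le_mul_of_nonneg_left hmonoZ hγ.le
      have h2 := mul_le_mul_of_nonneg_left hmonoW (inv_nonneg.2 hν.le)
      simp only [hUn, hGn] at hineq h1 h2 hZs ⊢
      linarith
    rw [← ENNReal.ofReal_toReal hfinσ.ne]
    refine ENNReal.ofReal_le_ofReal ?_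
    rw [le_div_iff₀ hγ, mul_comm]
    exact hreal
  -- the error integrals tend to zero along the subsequence
  have hWlim : ∀ t, 0 < t → Tendsto (fun j => W (φ j) t) atTop (𝓝 0) := by
    intro t ht
    -- `Gn - f + γUn = (Gn - F) + γ(Un - u)` pointwise
    have hsplit : ∀ n τ x, Gn n τ x - f x + γ • Un n τ x = (Gn n τ x - F τ x) + γ • (Un n τ x - u τ x) := by
      intro n τ x
      simp only [hFdef, smul_sub]
      abel
    -- measurability of the first summand in `x`, for every `τ ≥ 0`
    have hmeas : ∀ n τ, 0 ≤ τ → AEMeasurable (fun x => 2 * ‖Gn n τ x - F τ x‖ₑ ^ 2) volume := by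
      intro n τ hτ
      have h1 : AEStronglyMeasurable (Gn n τ) volume := (continuous_realTrigPoly _ _).aestronglyMeasurable
      have h2 : AEStronglyMeasurable (F τ) volume := by
        simp only [hFdef]
        exact hfc.aestronglyMeasurable.sub ((hu.memLp_two hτ).1.const_smul γ)
      exact ((h1.sub h2).enorm.pow_const 2).const_mul 2
    have hγtop : (2 : ℝ≥0∞) * ‖γ‖ₑ ^ 2 ≠ ⊤ :=
      ENNReal.mul_ne_top ENNReal.ofNat_ne_top (ENNReal.pow_ne_top enorm_ne_top)
    have hbound : ∀ n, W n t ≤ 2 * (∫⁻ τ in Ioo 0 t, ∫⁻ x, ‖Gn n τ x - F τ x‖ₑ ^ 2) +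
        2 * ‖γ‖ₑ ^ 2 * ∫⁻ τ in Ioo 0 t, ∫⁻ x, ‖Un n τ x - u τ x‖ₑ ^ 2 := by
      intro n
      have hFmeas : AEMeasurable (fun τ => ∫⁻ x, 2 * ‖Gn n τ x - F τ x‖ₑ ^ 2) (volume.restrict (Ioo 0 t)) := by
        have hG : AEStronglyMeasurable (Function.uncurry (Gn n)) ((volume.restrict (Ioo 0 t)).prod volume) :=
          aestronglyMeasurable_uncurry_prod_of_stLift
            ((hGS.continuousOn_force n).aestronglyMeasurable (measurableSet_Ici.prod MeasurableSet.univ)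
              |>.mono_measure (Measure.restrict_mono (prod_mono Ioi_subset_Ici_self subset_rfl) le_rfl)) t
        have hF' : AEStronglyMeasurable (Function.uncurry F) ((volume.restrict (Ioo 0 t)).prod volume) :=
          aestronglyMeasurable_uncurry_prod_of_stLift hFm t
        exact (((hG.sub hF').aemeasurable.enorm.pow_const 2).const_mul 2).lintegral_prod_right'
      calc W n t = ∫⁻ τ in Ioo 0 t, ∫⁻ x, ‖(Gn n τ x - F τ x) + γ • (Un n τ x - u τ x)‖ₑ ^ 2 := by
            simp only [hW, hsplit]
        _ ≤ ∫⁻ τ in Ioo 0 t, ∫⁻ x, (2 * ‖Gn n τ x - F τ x‖ₑ ^ 2 + 2 * (‖γ‖ₑ ^ 2 * ‖Un n τ x - u τ x‖ₑ ^ 2)) :=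
            lintegral_mono fun τ => lintegral_mono fun x => enorm_add_smul_sq_le _ _ γ
        _ = ∫⁻ τ in Ioo 0 t, ((∫⁻ x, 2 * ‖Gn n τ x - F τ x‖ₑ ^ 2) +
              ∫⁻ x, 2 * (‖γ‖ₑ ^ 2 * ‖Un n τ x - u τ x‖ₑ ^ 2)) :=
            setLIntegral_congr_fun measurableSet_Ioo fun τ hτ => lintegral_add_left' (hmeas n τ hτ.1.le) _
        _ = (∫⁻ τ in Ioo 0 t, ∫⁻ x, 2 * ‖Gn n τ x - F τ x‖ₑ ^ 2) +
              ∫⁻ τ in Ioo 0 t, ∫⁻ x, 2 * (‖γ‖ₑ ^ 2 * ‖Un n τ x - u τ x‖ₑ ^ 2) := lintegral_add_left' hFmeas _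
        _ = 2 * (∫⁻ τ in Ioo 0 t, ∫⁻ x, ‖Gn n τ x - F τ x‖ₑ ^ 2) +
              2 * ‖γ‖ₑ ^ 2 * ∫⁻ τ in Ioo 0 t, ∫⁻ x, ‖Un n τ x - u τ x‖ₑ ^ 2 := by
            congr 1
            · rw [← lintegral_const_mul' 2 _ ENNReal.ofNat_ne_top]
              exact lintegral_congr fun τ => lintegral_const_mul' 2 _ ENNReal.ofNat_ne_top
            · rw [← lintegral_const_mul' (2 * ‖γ‖ₑ ^ 2) _ hγtop]
              refine lintegral_congr fun τ => ?_
              rw [← lintegral_const_mul' (2 * ‖γ‖ₑ ^ 2) _ hγtop]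
              exact lintegral_congr fun x => by ring
    -- the two error terms tend to zero along `φ`
    have hforce : Tendsto (fun j => ∫⁻ τ in Ioo 0 t, ∫⁻ x, ‖Gn (φ j) τ x - F τ x‖ₑ ^ 2) atTop (𝓝 0) :=
      hGS'.tendsto_force t ht
    have hvel : Tendsto (fun j => ∫⁻ τ in Ioo 0 t, ∫⁻ x, ‖Un (φ j) τ x - u τ x‖ₑ ^ 2) atTop (𝓝 0) := by
      have h := hGS'.tendsto_lintegral_enorm_sub_sq hν hu₀ hFm hF2 hvm hv2 hc ht
      refine h.congr fun j => setLIntegral_congr_fun measurableSet_Ioo fun τ hτ => ?_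
      refine lintegral_congr_ae ?_
      filter_upwards [hae τ hτ.1] with x hx
      simp only [Function.comp_apply, hx]
    have hsum : Tendsto (fun j => 2 * (∫⁻ τ in Ioo 0 t, ∫⁻ x, ‖Gn (φ j) τ x - F τ x‖ₑ ^ 2) +
        2 * ‖γ‖ₑ ^ 2 * ∫⁻ τ in Ioo 0 t, ∫⁻ x, ‖Un (φ j) τ x - u τ x‖ₑ ^ 2) atTop (𝓝 0) := by
      have h1 := ENNReal.Tendsto.const_mul (a := (2 : ℝ≥0∞)) hforce (Or.inr ENNReal.ofNat_ne_top)
      have h2 := ENNReal.Tendsto.const_mul (a := (2 : ℝ≥0∞) * ‖γ‖ₑ ^ 2) hvel (Or.inr hγtop)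
      rw [mul_zero] at h1 h2
      simpa using h1.add h2
    exact tendsto_of_tendsto_of_tendsto_of_le_of_le tendsto_const_nhds hsum (fun _ => bot_le)
      fun j => hbound (φ j)
  -- Fatou in time along the subsequence, and transfer from `v` to `u`
  refine ⟨Bσ / γ, by positivity, fun t ht => ?_⟩
  have ht0 : 0 < t := hσ.trans_le ht
  -- slicewise Fatou
  have hFatou : ∫⁻ τ in Ioo σ t, eGradNormSq (v τ) ≤
      liminf (fun j => ∫⁻ τ in Ioo σ t, eGradNormSq (Un (φ j) τ)) atTop :=
    calc ∫⁻ τ in Ioo σ t, eGradNormSq (v τ)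
        ≤ ∫⁻ τ in Ioo σ t, liminf (fun j => eGradNormSq (Un (φ j) τ)) atTop :=
          setLIntegral_mono' measurableSet_Ioo fun τ hτ =>
            eGradNormSq_le_liminf_of_tendsto_mFourierCoeff hc (hσ.trans hτ.1).le
      _ ≤ liminf (fun j => ∫⁻ τ in Ioo σ t, eGradNormSq (Un (φ j) τ)) atTop :=
          lintegral_liminf_le' fun j => (hGS'.aemeasurable_eGradNormSq j t).mono_measure
            (Measure.restrict_mono (Ioo_subset_Ioo hσ.le le_rfl) le_rfl)
  -- the right-hand sides converge
  have hR : Tendsto (fun j => ENNReal.ofReal ((Bσ + ν⁻¹ * (W (φ j) t).toReal + t * Zf / γ) / γ)) atTop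
      (𝓝 (ENNReal.ofReal ((Bσ + ν⁻¹ * 0 + t * Zf / γ) / γ))) := by
    have hW0 : Tendsto (fun j => (W (φ j) t).toReal) atTop (𝓝 0) := by
      have h := (ENNReal.tendsto_toReal ENNReal.zero_ne_top).comp (hWlim t ht0)
      rwa [ENNReal.toReal_zero] at h
    refine ENNReal.tendsto_ofReal (Tendsto.div_const (Tendsto.add_const _ (Tendsto.const_add _ ?_)) _)
    exact hW0.const_mul _
  rw [mul_zero, add_zero] at hR
  have hlim : liminf (fun j => ∫⁻ τ in Ioo σ t, eGradNormSq (Un (φ j) τ)) atTop ≤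
      ENNReal.ofReal ((Bσ + t * Zf / γ) / γ) := by
    refine (liminf_le_liminf (Eventually.of_forall fun j => hH (φ j) t ht)).trans_eq hR.liminf_eq
  have hcongr : ∫⁻ τ in Ioo σ t, eGradNormSq (u τ) = ∫⁻ τ in Ioo σ t, eGradNormSq (v τ) :=
    setLIntegral_congr_fun measurableSet_Ioo fun τ hτ => eGradNormSq_congr_ae (hae τ (hσ.trans hτ.1))
  rw [hcongr]
  refine (hFatou.trans hlim).trans (ENNReal.ofReal_le_ofReal (le_of_eq ?_))
  rw [hZfdef]
  field_simp

end Interior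

/-! ## Part D. The mean energy dissipation rate vanishes with the viscosity -/

section Assembly

/-- **The mean energy dissipation rate of the damped–driven 2-D flow is `O(ν)`**
(Constantin–Ramos 2007, §1: "The absence of anomalous dissipation of energy follows immediately
from the bounds in the second section"): for `ν, γ > 0`, `f` Lipschitz with constant `K`,
`u₀ ∈ L²` weakly divergence free and a global Leray–Hopf solution `u` with force `f - γu`,
`0 ≤ ⟨ν‖∇u‖₂²⟩ ≤ ν · 2K²/γ²` (limsup of the running means; `damped_enstrophy_integral_bound`
bounds `∫₀ᵀ‖∇u‖₂² ≤ C' + T·2K²/γ²`, so the running means are `≤ νC'/T + ν·2K²/γ²`). [cite: ConstantinRamos2007, §1 and §2 Thm 2.1] -/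
theorem meanDissipation_le_of_damped {ν γ : ℝ} (hν : 0 < ν) (hγ : 0 < γ)
    {f : UnitAddTorus (Fin 2) → EuclideanSpace ℝ (Fin 2)} {K : ℝ≥0} (hf : LipschitzWith K f)
    {u₀ : UnitAddTorus (Fin 2) → EuclideanSpace ℝ (Fin 2)} (hu₀ : MemLp u₀ 2 volume)
    (hu₀div : FunctionSpaces.Torus.IsWeaklyDivFree u₀)
    {u : ℝ → UnitAddTorus (Fin 2) → EuclideanSpace ℝ (Fin 2)} (hu : Torus.IsGlobalLerayHopf ν (fun t x => f x - γ • u t x) u₀ u) :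
    0 ≤ meanDissipation ν u ∧ meanDissipation ν u ≤ ν * (2 * (K : ℝ) ^ 2 / γ ^ 2) := by
  obtain ⟨C, hC0, hC⟩ := damped_enstrophy_integral_bound hν hγ hf hu₀ hu₀div hu one_pos
  unfold meanDissipation longTimeAvgSup
  set Zf : ℝ := 2 * (K : ℝ) ^ 2 with hZf
  set g : ℝ → ℝ := fun t => ν * (eGradNormSq (u t)).toReal with hg
  -- the head `∫⁻_{(0,1]} ‖∇u‖²` is finite
  set D₀ : ℝ≥0∞ := ∫⁻ τ in Ioc 0 1, eGradNormSq (u τ) with hD₀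
  have hsub : Ioc (0 : ℝ) 1 ⊆ Ioo 0 2 := fun τ hτ => ⟨hτ.1, hτ.2.trans_lt one_lt_two⟩
  have hD₀fin : D₀ < ⊤ :=
    lt_of_le_of_lt (lintegral_mono_set hsub) ((hu 2 two_pos).lintegral_eGradNormSq_lt_top)
  -- the running means for `T > 1`
  have hmean : ∀ T, 1 < T → timeMean g T ≤ ν * (D₀.toReal + C) / T + ν * (Zf / γ ^ 2) := by
    intro T hT
    have hT0 : 0 < T := one_pos.trans hT
    have hLH := hu T hT0
    have hfinT : ∫⁻ τ in Ioo 0 T, eGradNormSq (u τ) < ⊤ := hLH.lintegral_eGradNormSq_lt_top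
    have hint : ∫ t in (0 : ℝ)..T, g t = ν * (∫⁻ τ in Ioo 0 T, eGradNormSq (u τ)).toReal := by
      rw [intervalIntegral.integral_of_le hT0.le, integral_Ioc_eq_integral_Ioo]
      simp only [hg]
      rw [integral_const_mul, integral_toReal hLH.aemeasurable_eGradNormSq
        (ae_lt_top' hLH.aemeasurable_eGradNormSq hfinT.ne)]
    have hsplit : ∫⁻ τ in Ioo 0 T, eGradNormSq (u τ) ≤ D₀ + ENNReal.ofReal (C + T * Zf / γ ^ 2) :=
      calc ∫⁻ τ in Ioo 0 T, eGradNormSq (u τ) ≤ ∫⁻ τ in Ioc 0 1 ∪ Ioo 1 T, eGradNormSq (u τ) :=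
            lintegral_mono_set (by rw [Ioc_union_Ioo_eq_Ioo zero_le_one hT])
        _ ≤ D₀ + ∫⁻ τ in Ioo 1 T, eGradNormSq (u τ) := lintegral_union_le _ _ _
        _ ≤ D₀ + ENNReal.ofReal (C + T * Zf / γ ^ 2) := add_le_add le_rfl (hC T hT.le)
    have htoReal : (∫⁻ τ in Ioo 0 T, eGradNormSq (u τ)).toReal ≤ D₀.toReal + (C + T * Zf / γ ^ 2) := by
      have h := ENNReal.toReal_mono (ENNReal.add_ne_top.2 ⟨hD₀fin.ne, ENNReal.ofReal_ne_top⟩) hsplit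
      rwa [ENNReal.toReal_add hD₀fin.ne ENNReal.ofReal_ne_top, ENNReal.toReal_ofReal (by positivity)] at h
    rw [timeMean, hint]
    calc T⁻¹ * (ν * (∫⁻ τ in Ioo 0 T, eGradNormSq (u τ)).toReal)
        ≤ T⁻¹ * (ν * (D₀.toReal + (C + T * Zf / γ ^ 2))) := by gcongr
      _ = ν * (D₀.toReal + C) / T + ν * (Zf / γ ^ 2) := by
          field_simp
          ring
  -- nonnegativity of the running means for `T > 0`
  have hmean0 : ∀ T, 0 < T → 0 ≤ timeMean g T := fun T hT => by
    rw [timeMean]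
    exact mul_nonneg (inv_nonneg.2 hT.le) (intervalIntegral.integral_nonneg hT.le fun t _ =>
      mul_nonneg hν.le ENNReal.toReal_nonneg)
  have hev0 : ∀ᶠ T in atTop, 0 ≤ timeMean g T := (eventually_gt_atTop 0).mono hmean0
  have hcobdd : IsCoboundedUnder (· ≤ ·) atTop (timeMean g) := isCoboundedUnder_le_of_eventually_le atTop hev0
  have hbdd : IsBoundedUnder (· ≤ ·) atTop (timeMean g) := by
    refine isBoundedUnder_of_eventually_le (a := ν * (D₀.toReal + C) + ν * (Zf / γ ^ 2)) ?_
    filter_upwards [eventually_gt_atTop 1] with T hT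
    refine (hmean T hT).trans (add_le_add ?_ le_rfl)
    exact div_le_self (by positivity) hT.le
  refine ⟨le_limsup_of_frequently_le hev0.frequently hbdd, ?_⟩
  refine le_of_forall_pos_le_add fun ε hε => limsup_le_of_le hcobdd ?_
  have hsmall : ∀ᶠ T in atTop, ν * (D₀.toReal + C) / T < ε := by
    have ht : Tendsto (fun T : ℝ => ν * (D₀.toReal + C) / T) atTop (𝓝 0) :=
      tendsto_const_nhds.div_atTop tendsto_id
    exact (tendsto_order.1 ht).2 ε hε
  filter_upwards [hsmall, eventually_gt_atTop 1] with T h1 h2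
  have h3 := hmean T h2
  rw [hZf] at h3
  linarith

/-- **turb.S25 — no anomalous dissipation of energy for the damped and driven 2-D Navier–Stokes
equations; discharge of the named fact `constantin_ramos_2d`** (Constantin–Ramos, *Inviscid
limit for damped and driven incompressible Navier–Stokes equations in `ℝ²`*, CMP 275 (2007) =
arXiv:math/0611782, §1: "Our results apply to the spatially periodic boundary conditions as
well. The absence of anomalous dissipation of energy follows immediately from the bounds in the
second section", with §2, Thm 2.1: energy equality
`d/2dt ∫|u|² + γ∫|u|² + ν∫|∇u|² = ∫ f·u` and the enstrophy bound
`‖ω(t)‖₂ ≤ e^{-γt}{‖ω₀‖₂ - γ⁻¹‖∇⊥·f‖₂} + γ⁻¹‖∇⊥·f‖₂`, "with bounds independent of viscosity", so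
that `ν⟨‖∇u‖₂²⟩ = ν⟨‖ω‖₂²⟩ → 0`). On `𝕋²`, for `γ > 0`, a steady Lipschitz weakly
divergence-free force `f`, an `L²` weakly divergence-free datum `u₀`, viscosities `νⱼ > 0`,
`νⱼ → 0`, and global Leray–Hopf solutions `uⱼ` of the systems with forces `f - γuⱼ`:
`νⱼ ⟨‖∇uⱼ‖₂²⟩ → 0`. *Proof architecture (Lean).* For `L²` data the enstrophy is infinite at
`t = 0`, so the enstrophy bound is used in time-integrated form on `[σ, t]`, which bounds the
Cesàro means directly (`meanDissipation_le_of_damped`: `0 ≤ ⟨νⱼ‖∇uⱼ‖₂²⟩ ≤ νⱼ·2K²/γ²`, `K` the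
Lipschitz constant, `2K² ≥ ‖∇f‖₂²`); the integrated damped enstrophy inequality for the rough
Leray–Hopf solution is obtained at the level of the Fourier–Galerkin approximations of the
problem with the *frozen* force `f - γuⱼ` (`galerkin_damped_enstrophy_ineq`, the 2-D
orthogonality `b(u,u,Δu) = 0` being FMRT (A.62)), passed to the limit by the tree's
`L²ₜₓ`-convergence of the Hopf–Galerkin scheme and identified with `uⱼ` by the Lions–Prodi
uniqueness theorem (`lions_prodi_uniqueness_torus2_holds`, FMRT Thm. 7.3)
(`damped_enstrophy_integral_bound`); then squeeze. The weak divergence-freeness of `f` is not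
needed (a gradient part of the force is invisible to Leray–Hopf solutions). [cite: ConstantinRamos2007, §1 (absence of anomalous energy dissipation, periodic case) and §2 Thm 2.1 (uniform energy/enstrophy bounds independent of ν)] -/
theorem constantin_ramos_2d_holds : constantin_ramos_2d := by
  intro γ hγ f K hf _hfdiv u₀ hu₀ hu₀div ν hν hν₀ u hu
  have hb := fun j => meanDissipation_le_of_damped (hν j) hγ hf hu₀ hu₀div (hu j)
  have hlim : Tendsto (fun j => ν j * (2 * (K : ℝ) ^ 2 / γ ^ 2)) atTop (𝓝 0) := by
    simpa using hν₀.mul_const (2 * (K : ℝ) ^ 2 / γ ^ 2)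
  exact tendsto_of_tendsto_of_tendsto_of_le_of_le tendsto_const_nhds hlim (fun j => (hb j).1)
    fun j => (hb j).2

end Assembly

end Literature.Analysis.FluidPDE

end
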